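import Summits.QuantumFields.BalabanUV.Gaps.D1WardPinsBorderWeight
import Summits.QuantumFields.BalabanUV.Gaps.D1PinnedColourLineReadings
import Summits.QuantumFields.BalabanUV.Gaps.D1PinnedColourPolynomialAlgebra

/-!
# `BalabanUV.Gaps.D1WardBorderWeightPolynomial` — cell pub-balaban-gaps, row (D1), seat g1-p1: ON THE PINNED FAMILY EVERY ZEROTH MOMENT OF A STEP KERNEL IS ONE REAL POLYNOMIAL OF TOTAL
# DEGREE ≤ 4 WITHOUT LINEAR PART IN PRINT's COLOUR TRIPLE (level by level, off the pin), so THE WARD-COMPATIBLE BORDER WEIGHT OF `Gaps/D1WardPinsBorderWeight` IS SUCH A POLYNOMIAL TOO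

HONEST FRAMING (cell rule, page 1 of everything): [folklore] kernel algebra BY NAME — GEN 12's ENTRYWISE five-node laws along affine lines and rays of colour triples
(`D1PinnedColourLineReadings.TbalOf_JsBalAn1_line_nodes`, `D1PinnedColourRayReadings.TbalOf_JsBalAn1_ray_nodes`), GEN 13's packaging `D1PinnedColourPolynomialAlgebra.exists_mvPolynomial_deg_le_four`
(tensor Lagrange + the ray law kills the linear part), GEN 15's `D1WardPinsBorderWeight` (step kernels affine in `cB` entrywise; `hW` ⟹ `m₀(flipK T_j(c⃗;0;T)) + cB·m₀(unit border_j) = 0`),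
an1's `OddMoments.zerothMoment ∕ summable_self`, GEN 14's `momentSummable_flipK_TbalOf`.  `hW` is a HYPOTHESIS about members of the cells' OWN pinned family (the β-lead's candidate; (P6)
undecided); nothing of Bałaban's asserted; NO coefficient computed or signed; (D1) NOT discharged; 0∕4 row-D1 binders; NOT `BetaPertH`, NOT continuum, NOT Clay.
HONEST DEPENDENCY (b2b cell, verbatim): «continuum YM on T⁴ ⇐ BetaPertH ∧ nine spine estimates (0/9 proved); BetaPertH ⇐ (D1) ∧ (D4) ∧ CAP+tail; G-an2-4 gates asym, D1 and NE2/3/4.»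

CONTENT (all [folklore]; no `def`, 0 sorry): §1 `zerothMoment_wsum5` (zeroth moments of a five-term entrywise combination); §2 `zerothMoment_flipK_JsBalAn1_line_nodes ∕ _ray_nodes` (the five-node
laws pass to zeroth moments of the flipped step kernels), **`zerothMoment_eq_eval_mvPolynomial`** (for every level, root, `cE₂`, `cB`, table, channel: `c⃗ ↦ m₀(flipK T_j(c⃗; cB; T); c, e)` is
`MvPolynomial.eval c⃗ Q` for ONE `Q` with `totalDegree ≤ 4`, `homogeneousComponent 1 = 0`); §3 **`wardBorderWeight_eq_eval_mvPolynomial`** — if the unit border tower has a nonzero zeroth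
moment in channel `(c,e)` at level `j` (colour-free by `unitBorder_zerothMoment_colour_free`), there is ONE polynomial `R` (`totalDegree ≤ 4`, no linear part) such that for EVERY colour
triple and border weight: `hW` at level `j` for the member `(c⃗; cB; T)` ⟹ `cB = eval c⃗ R` — the Ward-compatible border weight is a quartic polynomial function of print's colour triple.

Provenance: cell pub-balaban-gaps, seat g1-p1 GEN 15 (prover-pub-balaban-gaps-g1-p1-g15-0), 2026-08-25; imports three landed∕filed Gaps files only; no existing file touched.
-/

noncomputable section

open Literature.MathematicalPhysics.QuantumFieldTheory Balaban1983to89 Balaban1983to89.Beta Filter Topology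
open OneStepResolventKernel (JetData)
open OneStepKernelFamily (TbalOf flipK)
open PolarizationSign (WardTransversal MomentSummable)
open OddMoments (zerothMoment summable_self)
open AffineAveraging (box)
open Summit.QuantumFields.BalabanUV.Beta.MixedJetTablesPlug (JsBalAn1)
open Summit.QuantumFields.BalabanUV.Gaps.D1IndexSymmetryDictionary (momentSummable_flipK_TbalOf)
open Summit.QuantumFields.BalabanUV.Gaps.D1PinnedColourLineReadings (TbalOf_JsBalAn1_line_nodes)
open Summit.QuantumFields.BalabanUV.Gaps.D1PinnedColourRayReadings (TbalOf_JsBalAn1_ray_nodes)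
open Summit.QuantumFields.BalabanUV.Gaps.D1PinnedColourPolynomialAlgebra (exists_mvPolynomial_deg_le_four)
open Summit.QuantumFields.BalabanUV.Gaps.D1WardPinsBorderWeight (borderWeight_eq_of_ward unitBorder_zerothMoment_colour_free)

namespace Summit.QuantumFields.BalabanUV.Gaps.D1WardBorderWeightPolynomial

/-! ## §1 Zeroth moments of a five-term entrywise combination -/

section Generic

variable {d : ℕ}

/-- [folklore] If `P = Σᵢ wᵢ·Pᵢ` entrywise (five summable kernels), then `m₀(P; a,b) = Σᵢ wᵢ·m₀(Pᵢ; a,b)`. -/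
theorem zerothMoment_wsum5 {P P₀ P₁ P₂ P₃ P₄ : B12Beta.Kernel d} (h₀ : MomentSummable P₀ 3) (h₁ : MomentSummable P₁ 3) (h₂ : MomentSummable P₂ 3) (h₃ : MomentSummable P₃ 3)
    (h₄ : MomentSummable P₄ 3) (w₀ w₁ w₂ w₃ w₄ : ℝ) (hP : ∀ a b z, P a b z = w₀ * P₀ a b z + w₁ * P₁ a b z + w₂ * P₂ a b z + w₃ * P₃ a b z + w₄ * P₄ a b z)
    (a b : Fin d) :
    zerothMoment P a b = w₀ * zerothMoment P₀ a b + w₁ * zerothMoment P₁ a b + w₂ * zerothMoment P₂ a b + w₃ * zerothMoment P₃ a b + w₄ * zerothMoment P₄ a b := by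
  unfold OddMoments.zerothMoment
  have s₀ := (summable_self h₀ a b).mul_left w₀
  have s₁ := (summable_self h₁ a b).mul_left w₁
  have s₂ := (summable_self h₂ a b).mul_left w₂
  have s₃ := (summable_self h₃ a b).mul_left w₃
  have s₄ := (summable_self h₄ a b).mul_left w₄
  rw [← tsum_mul_left, ← tsum_mul_left, ← tsum_mul_left, ← tsum_mul_left, ← tsum_mul_left, ← Summable.tsum_add s₀ s₁, ← Summable.tsum_add (s₀.add s₁) s₂,
    ← Summable.tsum_add ((s₀.add s₁).add s₂) s₃, ← Summable.tsum_add (((s₀.add s₁).add s₂).add s₃) s₄]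
  exact tsum_congr fun z => hP a b z

end Generic

/-! ## §2 The pinned family: zeroth moments along lines and rays of colour triples; ONE polynomial of total degree ≤ 4 without linear part -/

section Pinned

variable {Lc : ℕ} [NeZero Lc] {r : Fin (3 + 1) → ℕ}

/-- [folklore] THE FIVE-NODE LAW ALONG AN AFFINE LINE OF COLOUR TRIPLES for the zeroth moments of the flipped step kernels (GEN 12's entrywise `TbalOf_JsBalAn1_line_nodes`). -/
theorem zerothMoment_flipK_JsBalAn1_line_nodes (hLc : 1 ≤ Lc) (hr : r ∈ box (3 + 1) Lc) (cE₀ cVH₀ cΛ₀ cE₁ cVH₁ cΛ₁ cE₂ cB : ℝ) (T : Fin 4 → Fin 4 → Fin 4 → Fin 4 → ℝ) (j : ℕ)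
    (t s₀ s₁ s₂ s₃ s₄ w₀ w₁ w₂ w₃ w₄ : ℝ) (hm0 : w₀ + w₁ + w₂ + w₃ + w₄ = 1) (hm1 : w₀ * s₀ + w₁ * s₁ + w₂ * s₂ + w₃ * s₃ + w₄ * s₄ = t)
    (hm2 : w₀ * s₀ ^ 2 + w₁ * s₁ ^ 2 + w₂ * s₂ ^ 2 + w₃ * s₃ ^ 2 + w₄ * s₄ ^ 2 = t ^ 2)
    (hm3 : w₀ * s₀ ^ 3 + w₁ * s₁ ^ 3 + w₂ * s₂ ^ 3 + w₃ * s₃ ^ 3 + w₄ * s₄ ^ 3 = t ^ 3) (hm4 : w₀ * s₀ ^ 4 + w₁ * s₁ ^ 4 + w₂ * s₂ ^ 4 + w₃ * s₃ ^ 4 + w₄ * s₄ ^ 4 = t ^ 4)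
    (a b : Fin 4) :
    zerothMoment (flipK (TbalOf Lc (JsBalAn1 hLc hr (cE₀ + t * cE₁) (cVH₀ + t * cVH₁) (cΛ₀ + t * cΛ₁) cE₂ cB T) j)) a b =
      w₀ * zerothMoment (flipK (TbalOf Lc (JsBalAn1 hLc hr (cE₀ + s₀ * cE₁) (cVH₀ + s₀ * cVH₁) (cΛ₀ + s₀ * cΛ₁) cE₂ cB T) j)) a b +
        w₁ * zerothMoment (flipK (TbalOf Lc (JsBalAn1 hLc hr (cE₀ + s₁ * cE₁) (cVH₀ + s₁ * cVH₁) (cΛ₀ + s₁ * cΛ₁) cE₂ cB T) j)) a b +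
        w₂ * zerothMoment (flipK (TbalOf Lc (JsBalAn1 hLc hr (cE₀ + s₂ * cE₁) (cVH₀ + s₂ * cVH₁) (cΛ₀ + s₂ * cΛ₁) cE₂ cB T) j)) a b +
        w₃ * zerothMoment (flipK (TbalOf Lc (JsBalAn1 hLc hr (cE₀ + s₃ * cE₁) (cVH₀ + s₃ * cVH₁) (cΛ₀ + s₃ * cΛ₁) cE₂ cB T) j)) a b +
        w₄ * zerothMoment (flipK (TbalOf Lc (JsBalAn1 hLc hr (cE₀ + s₄ * cE₁) (cVH₀ + s₄ * cVH₁) (cΛ₀ + s₄ * cΛ₁) cE₂ cB T) j)) a b :=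
  zerothMoment_wsum5 (momentSummable_flipK_TbalOf _ j 3) (momentSummable_flipK_TbalOf _ j 3) (momentSummable_flipK_TbalOf _ j 3) (momentSummable_flipK_TbalOf _ j 3)
    (momentSummable_flipK_TbalOf _ j 3) w₀ w₁ w₂ w₃ w₄ (fun a' b' z => by
      simp only [OneStepKernelFamily.flipK_apply]
      exact TbalOf_JsBalAn1_line_nodes hLc hr cE₀ cVH₀ cΛ₀ cE₁ cVH₁ cΛ₁ cE₂ cB T j t s₀ s₁ s₂ s₃ s₄ w₀ w₁ w₂ w₃ w₄ hm0 hm1 hm2 hm3 hm4 a' b' (-z)) a b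

/-- [folklore] THE FOUR-NODE LAW ALONG A COLOUR RAY for the zeroth moments of the flipped step kernels (GEN 12's entrywise `TbalOf_JsBalAn1_ray_nodes`; no first-moment condition on the weights). -/
theorem zerothMoment_flipK_JsBalAn1_ray_nodes (hLc : 1 ≤ Lc) (hr : r ∈ box (3 + 1) Lc) (cE cVH cΛ cE₂ cB : ℝ) (T : Fin 4 → Fin 4 → Fin 4 → Fin 4 → ℝ) (j : ℕ)
    (t s₀ s₁ s₂ s₃ s₄ w₀ w₁ w₂ w₃ w₄ : ℝ) (hm0 : w₀ + w₁ + w₂ + w₃ + w₄ = 1) (hm2 : w₀ * s₀ ^ 2 + w₁ * s₁ ^ 2 + w₂ * s₂ ^ 2 + w₃ * s₃ ^ 2 + w₄ * s₄ ^ 2 = t ^ 2)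
    (hm3 : w₀ * s₀ ^ 3 + w₁ * s₁ ^ 3 + w₂ * s₂ ^ 3 + w₃ * s₃ ^ 3 + w₄ * s₄ ^ 3 = t ^ 3) (hm4 : w₀ * s₀ ^ 4 + w₁ * s₁ ^ 4 + w₂ * s₂ ^ 4 + w₃ * s₃ ^ 4 + w₄ * s₄ ^ 4 = t ^ 4)
    (a b : Fin 4) :
    zerothMoment (flipK (TbalOf Lc (JsBalAn1 hLc hr (t * cE) (t * cVH) (t * cΛ) cE₂ cB T) j)) a b =
      w₀ * zerothMoment (flipK (TbalOf Lc (JsBalAn1 hLc hr (s₀ * cE) (s₀ * cVH) (s₀ * cΛ) cE₂ cB T) j)) a b +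
        w₁ * zerothMoment (flipK (TbalOf Lc (JsBalAn1 hLc hr (s₁ * cE) (s₁ * cVH) (s₁ * cΛ) cE₂ cB T) j)) a b +
        w₂ * zerothMoment (flipK (TbalOf Lc (JsBalAn1 hLc hr (s₂ * cE) (s₂ * cVH) (s₂ * cΛ) cE₂ cB T) j)) a b +
        w₃ * zerothMoment (flipK (TbalOf Lc (JsBalAn1 hLc hr (s₃ * cE) (s₃ * cVH) (s₃ * cΛ) cE₂ cB T) j)) a b +
        w₄ * zerothMoment (flipK (TbalOf Lc (JsBalAn1 hLc hr (s₄ * cE) (s₄ * cVH) (s₄ * cΛ) cE₂ cB T) j)) a b :=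
  zerothMoment_wsum5 (momentSummable_flipK_TbalOf _ j 3) (momentSummable_flipK_TbalOf _ j 3) (momentSummable_flipK_TbalOf _ j 3) (momentSummable_flipK_TbalOf _ j 3)
    (momentSummable_flipK_TbalOf _ j 3) w₀ w₁ w₂ w₃ w₄ (fun a' b' z => by
      simp only [OneStepKernelFamily.flipK_apply]
      exact TbalOf_JsBalAn1_ray_nodes hLc hr cE cVH cΛ cE₂ cB T j t s₀ s₁ s₂ s₃ s₄ w₀ w₁ w₂ w₃ w₄ hm0 hm2 hm3 hm4 a' b' (-z)) a b

/-- [folklore] **EVERY ZEROTH MOMENT OF A STEP KERNEL IS ONE REAL POLYNOMIAL OF TOTAL DEGREE ≤ 4 WITHOUT LINEAR PART IN THE COLOUR TRIPLE** — level by level, off the pin (any `1 ≤ Lc`,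
`cE₂`, `cB`, table, root, channel): `m₀(flipK T_j(c⃗; cB; T); a, b) = MvPolynomial.eval c⃗ Q`, `Q.totalDegree ≤ 4`, `Q.homogeneousComponent 1 = 0`, `Q.coeff 0` = the colour-free member's
zeroth moment (GEN 13's `exists_mvPolynomial_deg_le_four` fed with §2's line law at the Lagrange nodes `0,…,4` and ray law at `0,1,2,3`). -/
theorem zerothMoment_eq_eval_mvPolynomial (hLc : 1 ≤ Lc) (hr : r ∈ box (3 + 1) Lc) (cE₂ cB : ℝ) (T : Fin 4 → Fin 4 → Fin 4 → Fin 4 → ℝ) (j : ℕ) (a b : Fin 4) :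
    ∃ Q : MvPolynomial (Fin 3) ℝ, Q.totalDegree ≤ 4 ∧ Q.homogeneousComponent 1 = 0 ∧
      Q.coeff 0 = zerothMoment (flipK (TbalOf Lc (JsBalAn1 hLc hr 0 0 0 cE₂ cB T) j)) a b ∧
      ∀ cE cVH cΛ : ℝ, zerothMoment (flipK (TbalOf Lc (JsBalAn1 hLc hr cE cVH cΛ cE₂ cB T) j)) a b = MvPolynomial.eval ![cE, cVH, cΛ] Q := by
  refine exists_mvPolynomial_deg_le_four (fun cE cVH cΛ => zerothMoment (flipK (TbalOf Lc (JsBalAn1 hLc hr cE cVH cΛ cE₂ cB T) j)) a b)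
    (fun cE₀ cVH₀ cΛ₀ cE₁ cVH₁ cΛ₁ t => ?_) (fun cE cVH cΛ t => ?_)
  · have h := zerothMoment_flipK_JsBalAn1_line_nodes hLc hr cE₀ cVH₀ cΛ₀ cE₁ cVH₁ cΛ₁ cE₂ cB T j t 0 1 2 3 4 ((t - 1) * (t - 2) * (t - 3) * (t - 4) / 24)
      (-(t * (t - 2) * (t - 3) * (t - 4) / 6)) (t * (t - 1) * (t - 3) * (t - 4) / 4) (-(t * (t - 1) * (t - 2) * (t - 4) / 6)) (t * (t - 1) * (t - 2) * (t - 3) / 24)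
      (by ring) (by ring) (by ring) (by ring) (by ring) a b
    simp only [zero_mul, one_mul, add_zero] at h
    exact h
  · have h := zerothMoment_flipK_JsBalAn1_ray_nodes hLc hr cE cVH cΛ cE₂ cB T j t 0 1 2 3 0
      (1 - t ^ 2 * (t - 2) * (t - 3) / 2 + t ^ 2 * (t - 1) * (t - 3) / 4 - t ^ 2 * (t - 1) * (t - 2) / 18) (t ^ 2 * (t - 2) * (t - 3) / 2)
      (-(t ^ 2 * (t - 1) * (t - 3) / 4)) (t ^ 2 * (t - 1) * (t - 2) / 18) 0 (by ring) (by ring) (by ring) (by ring) a b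
    simp only [zero_mul, one_mul, add_zero] at h
    exact h

/-! ## §3 The Ward-compatible border weight is a quartic polynomial function of print's colour triple -/

/-- [folklore] **THE WARD-COMPATIBLE BORDER WEIGHT IS ONE POLYNOMIAL OF TOTAL DEGREE ≤ 4 WITHOUT LINEAR PART IN THE COLOUR TRIPLE.**  Fix a level `j`, root, `cE₂`, table `T` and a channel
`(c, e)` in which the unit border tower's zeroth moment `u := m₀(flipK T_j(c⃗₀;1;T) − flipK T_j(c⃗₀;0;T); c,e)` is NONZERO (it is colour-free: `unitBorder_zerothMoment_colour_free`).  Then there is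
ONE real polynomial `R` in three variables, `R.totalDegree ≤ 4`, `R.homogeneousComponent 1 = 0`, such that for EVERY colour triple `c⃗` and border weight `cB`: the Ward binder at level `j` for
the member `(c⃗; cB; T)` forces `cB = MvPolynomial.eval c⃗ R` (`R = −u⁻¹ · Q`, `Q` the polynomial of §2 for the member `cB = 0`). -/
theorem wardBorderWeight_eq_eval_mvPolynomial (hLc : 1 ≤ Lc) (hr : r ∈ box (3 + 1) Lc) (cE₀ cVH₀ cΛ₀ cE₂ : ℝ) (T : Fin 4 → Fin 4 → Fin 4 → Fin 4 → ℝ) (j : ℕ) {c e : Fin 4}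
    (hU : zerothMoment (fun a b w => flipK (TbalOf Lc (JsBalAn1 hLc hr cE₀ cVH₀ cΛ₀ cE₂ 1 T) j) a b w - flipK (TbalOf Lc (JsBalAn1 hLc hr cE₀ cVH₀ cΛ₀ cE₂ 0 T) j) a b w) c e ≠ 0) :
    ∃ R : MvPolynomial (Fin 3) ℝ, R.totalDegree ≤ 4 ∧ R.homogeneousComponent 1 = 0 ∧
      ∀ cE cVH cΛ cB : ℝ, WardTransversal (flipK (TbalOf Lc (JsBalAn1 hLc hr cE cVH cΛ cE₂ cB T) j)) → cB = MvPolynomial.eval ![cE, cVH, cΛ] R := by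
  set u := zerothMoment (fun a b w => flipK (TbalOf Lc (JsBalAn1 hLc hr cE₀ cVH₀ cΛ₀ cE₂ 1 T) j) a b w - flipK (TbalOf Lc (JsBalAn1 hLc hr cE₀ cVH₀ cΛ₀ cE₂ 0 T) j) a b w) c e with hu
  obtain ⟨Q, hQ4, hQ1, -, hQ⟩ := zerothMoment_eq_eval_mvPolynomial hLc hr cE₂ 0 T j c e
  refine ⟨MvPolynomial.C (-u⁻¹) * Q, ?_, ?_, fun cE cVH cΛ cB hW => ?_⟩
  · exact (MvPolynomial.totalDegree_mul _ _).trans (by rw [MvPolynomial.totalDegree_C, zero_add]; exact hQ4)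
  · rw [MvPolynomial.homogeneousComponent_C_mul, hQ1, mul_zero]
  · have hw := borderWeight_eq_of_ward hLc hr cE cVH cΛ cE₂ cB T j hW c e
    rw [unitBorder_zerothMoment_colour_free hLc hr cE cVH cΛ cE₀ cVH₀ cΛ₀ cE₂ T j c e, ← hu, hQ cE cVH cΛ] at hw
    rw [map_mul, MvPolynomial.eval_C]
    field_simp
    linarith

end Pinned

end Summit.QuantumFields.BalabanUV.Gaps.D1WardBorderWeightPolynomial

end
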